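import Summits.CriticalPhenomena.CardyFormulaZ2.Theorems.CardyDualCurrentCanonicalLimitFromExactCRRealForm
import Summits.CriticalPhenomena.CardyFormulaZ2.Theorems.CardyComplexConeEdgePrecompactMedialExplorationShiftData

/-!
# Translations and forward differences of exactly-CR templates
(crux stmt-CriticalPhenomena-11394 `CardyDualCurrent.CanonicalLimitFromExactCR`, line `registered`)

The crux is `DualCurrentTemplateR → TemplateCanonicalLimit` (r2 → r9, `Iff.rfl`), and its two
remaining registered stubs re-choose (SHAPE) resp. quantify over (SIZE) exactly-CR, deep-window
non-degenerate local parafermionic templates.  This file records, kernel-checked, one more piece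
of the structure of that class which the informal cycle reports of the line had only in prose
(lead c4, CYCLE5.md, remark 5): **the exactly-CR class is stable under lattice translations and
under forward differences.**

* `Shift.shift T w d hd` — the template `T` read `w` further on: passage vertices translated by
  `w`, local weights reading the translated window, range enlarged by a bound `d` on the medial
  displacement of the base vertices (`d = 2` for a unit translation,
  `edist_baseVertex_map_add_single_le`; `d` arbitrary for `w = 0`, which is the range-padding
  `Shift.pad`).  Its observable is `T.obs D (x + w) i` in EVERY discrete domain (`obs_shift`, a
  pointwise identity of integrands), a deep point of the shifted template is a deep point of `T`
  at `x + w` (`isDeep_add_of_isDeep_shift`), hence exact discrete holomorphicity in a domain and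
  in all admissible domains is inherited (`isExactCRIn_shift`, `isExactCR_shift`).  The medial
  graph of `ℤ²` being translation invariant (`medialGraph_edist_map_add`, from the corner
  bookkeeping `cornerSource_add` / `cornerTarget_add` of the `EdgePrecompact` crux files), all of
  this is transport of structure.
* `Shift.fdiff T j = shift_{e_j} T ⊕ (−1) · pad₂ T` — the forward difference in the coordinate
  direction `j`, a template of range `T.r + 2` with observable
  `T.obs D (x + e_j) i − T.obs D x i` on admissible data (`obs_fdiff`) which is exactly CR when
  `T` is (`isExactCRIn_fdiff`, `isExactCR_fdiff`).

Consequence for the line (informal, recorded in the cycle report): if some exactly-CR template `S`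
had the canonical projective limit `c_δ S → q` with `‖c_δ‖ ≍ δ^{-1/3}`, then (granted interior
gradient estimates) `fdiff S j` is an exactly-CR template whose renormalised limits are multiples
of `q'`, at scale `δ^{-4/3}`: the exactly-CR class carries every scaling dimension `1/3 + n`, and
exact CR alone fixes neither the Riemann–Hilbert datum (F3, `stub_limitAntiHolomorphic`) nor the
exponent `1/3` hard-wired in `TemplateCanonicalLimit`; the re-choice `∃ T` of the SHAPE stub and
the hypothesis "projective limit exists" of the SIZE stub are both essential.  Non-degeneracy is
NOT claimed to be inherited (a difference may vanish), and nothing here decides r2.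
-/

noncomputable section

namespace Summit.CriticalPhenomena.CardyFormulaZ2.Cruxes.CanonicalLimitFromExactCR.Birth

open scoped BigOperators
open Filter Set Complex MeasureTheory
open Literature.Probability Literature.Probability.LatticeModels
open Literature.Probability.Percolation (sym2Equiv sym2Equiv_mk)
open Summit.CriticalPhenomena.CardyFormulaZ2.Cruxes.EdgePrecompact.QkzStripBoundaryArm
  (isCorner_add_iff cornerSource_add cornerTarget_add exists_add_eq_site)
open RealForm (append smul append_r smul_r obs_append obs_smul isExactCRIn_append isExactCRIn_smul)

namespace Shift

/-! ### The medial graph of `ℤ²` is translation invariant -/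

/-- On unordered pairs of sites, `sym2Equiv (Site.shift w)` is `Sym2.map (· + w)`. [folklore] -/
theorem sym2Equiv_shift_apply (w : Site 2) (e : Sym2 (Site 2)) :
    sym2Equiv (Site.shift w) e = Sym2.map (· + w) e := rfl

/-- Medial darts are translation covariant. [folklore] -/
theorem isMedialDart_map_add_iff (w : Site 2) (e e' : MedialVertex) :
    IsMedialDart (Sym2.map (· + w) e) (Sym2.map (· + w) e') ↔ IsMedialDart e e' := by
  rw [← sym2Equiv_shift_apply, ← sym2Equiv_shift_apply]
  constructor
  · rintro ⟨v₁, f₁, hc, hs, ht⟩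
    obtain ⟨v, rfl⟩ := exists_add_eq_site w v₁
    obtain ⟨f, rfl⟩ := exists_add_eq_site w f₁
    rw [cornerSource_add] at hs
    rw [cornerTarget_add] at ht
    exact ⟨v, f, (isCorner_add_iff v f w).1 hc, (sym2Equiv _).injective hs,
      (sym2Equiv _).injective ht⟩
  · rintro ⟨v, f, hc, rfl, rfl⟩
    exact ⟨v + w, f + w, (isCorner_add_iff v f w).2 hc, cornerSource_add v f w,
      cornerTarget_add v f w⟩

/-- Adjacency in the medial graph is translation invariant. [folklore] -/
theorem medialGraph_adj_map_add_iff (w : Site 2) (e e' : MedialVertex) :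
    medialGraph.Adj (Sym2.map (· + w) e) (Sym2.map (· + w) e') ↔ medialGraph.Adj e e' := by
  rw [medialGraph_adj_iff, medialGraph_adj_iff, isMedialDart_map_add_iff,
    isMedialDart_map_add_iff, ← sym2Equiv_shift_apply, ← sym2Equiv_shift_apply,
    (sym2Equiv _).injective.ne_iff]

/-- Translation by `w` as an automorphism of the medial graph. [folklore] -/
def medialShiftIso (w : Site 2) : medialGraph ≃g medialGraph where
  toEquiv := sym2Equiv (Site.shift w)
  map_rel_iff' := fun {a b} => by
    rw [sym2Equiv_shift_apply, sym2Equiv_shift_apply]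
    exact medialGraph_adj_map_add_iff w a b

/-- The medial distance is translation invariant (a graph automorphism maps geodesics to walks
of the same length, in both directions; cf. `mirror_edist_iso` of the `PercolationContinuityZ3`
files, not imported here to keep the cone light). [folklore] -/
theorem medialGraph_edist_map_add (w : Site 2) (e e' : MedialVertex) :
    medialGraph.edist (Sym2.map (· + w) e) (Sym2.map (· + w) e') = medialGraph.edist e e' := by
  -- a homomorphism of the medial graph into itself does not increase `edist`
  have hom_le : ∀ (f : medialGraph →g medialGraph) (u v : MedialVertex),
      medialGraph.edist (f u) (f v) ≤ medialGraph.edist u v := by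
    intro f u v
    by_cases h : medialGraph.Reachable u v
    · obtain ⟨p, hp⟩ := h.exists_walk_length_eq_edist
      calc medialGraph.edist (f u) (f v) ≤ (p.map f).length := SimpleGraph.edist_le _
        _ = p.length := by rw [SimpleGraph.Walk.length_map]
        _ = medialGraph.edist u v := hp
    · rw [SimpleGraph.edist_eq_top_of_not_reachable h]
      exact le_top
  refine le_antisymm (hom_le (medialShiftIso w).toHom e e') ?_
  have h := hom_le (medialShiftIso w).symm.toHom (Sym2.map (· + w) e) (Sym2.map (· + w) e')
  have h1 : (medialShiftIso w).symm (Sym2.map (· + w) e) = e :=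
    (medialShiftIso w).symm_apply_apply e
  have h2 : (medialShiftIso w).symm (Sym2.map (· + w) e') = e' :=
    (medialShiftIso w).symm_apply_apply e'
  simpa [h1, h2] using h

/-- Composition of translations on medial vertices. [folklore] -/
theorem map_add_map_add (x w : Site 2) (e : MedialVertex) :
    Sym2.map (· + x) (Sym2.map (· + w) e) = Sym2.map (· + (x + w)) e := by
  rw [Sym2.map_map]
  congr 1
  funext a
  simp only [Function.comp_apply]
  abel

/-- Translating by `0` is the identity on medial vertices. [folklore] -/
theorem map_add_zero (e : MedialVertex) : Sym2.map (· + (0 : Site 2)) e = e := by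
  have : (fun a : Site 2 => a + 0) = id := funext fun a => add_zero a
  rw [this, Sym2.map_id, id]

/-- The two edges of a face at one of its corners are adjacent medial vertices (in either
order). [folklore] -/
theorem medialGraph_adj_of_corner {v f : Site 2} (hv : IsCorner v f) {e e' : MedialVertex}
    (h : (cornerSource v f = e ∧ cornerTarget v f = e') ∨
      (cornerSource v f = e' ∧ cornerTarget v f = e)) : medialGraph.Adj e e' := by
  rcases h with ⟨rfl, rfl⟩ | ⟨rfl, rfl⟩
  · exact medialGraph_adj_iff.2 ⟨cornerSource_ne_cornerTarget hv, Or.inl ⟨v, f, hv, rfl, rfl⟩⟩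
  · exact (medialGraph_adj_iff.2
      ⟨cornerSource_ne_cornerTarget hv, Or.inl ⟨v, f, hv, rfl, rfl⟩⟩).symm

/-- Two medial steps give medial distance at most `2`. [folklore] -/
theorem medialGraph_edist_le_two {a c : MedialVertex} (b : MedialVertex) (h₁ : medialGraph.Adj a b)
    (h₂ : medialGraph.Adj b c) : medialGraph.edist a c ≤ ((2 : ℕ) : ℕ∞) :=
  calc medialGraph.edist a c ≤ medialGraph.edist a b + medialGraph.edist b c :=
        SimpleGraph.edist_triangle
    _ = 1 + 1 := by
        rw [SimpleGraph.edist_eq_one_iff_adj.2 h₁, SimpleGraph.edist_eq_one_iff_adj.2 h₂]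
    _ = ((2 : ℕ) : ℕ∞) := by norm_num

/-- A unit translation moves a base vertex by medial distance at most `2` (two corner steps
through the perpendicular edge at the shared endpoint). [folklore] -/
theorem edist_baseVertex_map_add_single_le (i j : Fin 2) :
    medialGraph.edist s((0 : Site 2), Pi.single i 1)
      (Sym2.map (· + Pi.single j 1) s((0 : Site 2), Pi.single i 1)) ≤ ((2 : ℕ) : ℕ∞) := by
  fin_cases i <;> fin_cases j <;> simp only [Sym2.map_mk, zero_add]
  · -- horizontal base edge, horizontal shift: through the vertical edge at `e₀`
    exact medialGraph_edist_le_two s((Pi.single 0 1 : Site 2), Pi.single 0 1 + Pi.single 1 1)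
      (medialGraph_adj_of_corner (v := Pi.single 0 1) (f := 0) (by unfold LatticeModels.IsCorner; decide)
        (by decide))
      (medialGraph_adj_of_corner (v := Pi.single 0 1) (f := Pi.single 0 1)
        (by unfold LatticeModels.IsCorner; decide) (by decide))
  · -- horizontal base edge, vertical shift: through the vertical edge at `0`
    exact medialGraph_edist_le_two s((0 : Site 2), Pi.single 1 1)
      (medialGraph_adj_of_corner (v := 0) (f := 0) (by unfold LatticeModels.IsCorner; decide) (by decide))
      (medialGraph_adj_of_corner (v := Pi.single 1 1) (f := 0) (by unfold LatticeModels.IsCorner; decide)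
        (by decide))
  · -- vertical base edge, horizontal shift: through the horizontal edge at `0`
    exact medialGraph_edist_le_two s((0 : Site 2), Pi.single 0 1)
      (medialGraph_adj_of_corner (v := 0) (f := 0) (by unfold LatticeModels.IsCorner; decide) (by decide))
      (medialGraph_adj_of_corner (v := Pi.single 0 1) (f := 0) (by unfold LatticeModels.IsCorner; decide)
        (by decide))
  · -- vertical base edge, vertical shift: through the horizontal edge at `e₁`
    exact medialGraph_edist_le_two s((Pi.single 1 1 : Site 2), Pi.single 1 1 + Pi.single 0 1)
      (medialGraph_adj_of_corner (v := Pi.single 1 1) (f := 0) (by unfold LatticeModels.IsCorner; decide)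
        (by decide))
      (medialGraph_adj_of_corner (v := Pi.single 1 1) (f := Pi.single 1 1)
        (by unfold LatticeModels.IsCorner; decide) (by decide))

/-- If the base vertex moves by at most `d` under translation by `w`, a medial vertex within
distance `r` of the base vertex is, after translation, within distance `r + d`. [folklore] -/
theorem edist_map_add_le_of_le {i : Fin 2} {w : Site 2} {d r : ℕ}
    (hd : medialGraph.edist s((0 : Site 2), Pi.single i 1)
      (Sym2.map (· + w) s((0 : Site 2), Pi.single i 1)) ≤ (d : ℕ∞))
    {e : MedialVertex} (he : medialGraph.edist s((0 : Site 2), Pi.single i 1) e ≤ (r : ℕ∞)) :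
    medialGraph.edist s((0 : Site 2), Pi.single i 1) (Sym2.map (· + w) e) ≤ ((r + d : ℕ) : ℕ∞) := by
  calc medialGraph.edist s((0 : Site 2), Pi.single i 1) (Sym2.map (· + w) e)
      ≤ medialGraph.edist s((0 : Site 2), Pi.single i 1)
          (Sym2.map (· + w) s((0 : Site 2), Pi.single i 1)) +
        medialGraph.edist (Sym2.map (· + w) s((0 : Site 2), Pi.single i 1))
          (Sym2.map (· + w) e) := SimpleGraph.edist_triangle
    _ ≤ (d : ℕ∞) + (r : ℕ∞) := by
        refine add_le_add hd ?_
        rw [medialGraph_edist_map_add]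
        exact he
    _ = ((r + d : ℕ) : ℕ∞) := by push_cast; ring

/-! ### Translated templates -/

/-- The **translate** of a template by `w ∈ ℤ²` with range padding `d`: the `k`-th term reads the
passage vertex `z i k + w` and the local weight `g i k` evaluated on the open edges of the
ORIGINAL window translated by `w` (which lies inside the enlarged window of radius `T.r + d` as
soon as the base vertex moves by at most `d`, hypothesis `hd`).  Its observable at `x` is the
observable of `T` at `x + w` (`obs_shift`). [folklore] -/
def shift (T : LocalParafermionicTemplate) (w : Site 2) (d : ℕ)
    (hd : ∀ i : Fin 2, medialGraph.edist s((0 : Site 2), Pi.single i 1)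
      (Sym2.map (· + w) s((0 : Site 2), Pi.single i 1)) ≤ (d : ℕ∞)) :
    LocalParafermionicTemplate where
  r := T.r + d
  m := T.m
  z := fun i k => Sym2.map (· + w) (T.z i k)
  s := T.s
  g := fun i k P => T.g i k {e |
    medialGraph.edist s((0 : Site 2), Pi.single i 1) e ≤ (T.r : ℕ∞) ∧ Sym2.map (· + w) e ∈ P}
  dist_le := fun i k => edist_map_add_le_of_le (hd i) (T.dist_le i k)

variable {T : LocalParafermionicTemplate} {w : Site 2} {d : ℕ}
  {hd : ∀ i : Fin 2, medialGraph.edist s((0 : Site 2), Pi.single i 1)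
    (Sym2.map (· + w) s((0 : Site 2), Pi.single i 1)) ≤ (d : ℕ∞)}

/-- The range of a translate. [folklore] -/
theorem shift_r : (shift T w d hd).r = T.r + d := rfl

/-- The window pattern read by a translated local weight is the pattern of the original window at
the translated point. [folklore] -/
theorem shift_pattern_eq
    (hd : ∀ i : Fin 2, medialGraph.edist s((0 : Site 2), Pi.single i 1)
      (Sym2.map (· + w) s((0 : Site 2), Pi.single i 1)) ≤ (d : ℕ∞))
    (i : Fin 2) (x : Site 2) (ω : Set MedialVertex) :
    {e | medialGraph.edist s((0 : Site 2), Pi.single i 1) e ≤ (T.r : ℕ∞) ∧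
        Sym2.map (· + w) e ∈ {e' : MedialVertex |
          medialGraph.edist s((0 : Site 2), Pi.single i 1) e' ≤ ((T.r + d : ℕ) : ℕ∞) ∧
          Sym2.map (· + x) e' ∈ ω}} =
      {e | medialGraph.edist s((0 : Site 2), Pi.single i 1) e ≤ (T.r : ℕ∞) ∧
        Sym2.map (· + (x + w)) e ∈ ω} := by
  ext e
  simp only [mem_setOf_eq, map_add_map_add]
  constructor
  · rintro ⟨he, -, hω⟩
    exact ⟨he, hω⟩
  · rintro ⟨he, hω⟩
    exact ⟨he, edist_map_add_le_of_le (hd i) he, hω⟩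

/-- **The observable of the translate is the translated observable**, in every discrete domain
(the two integrands agree pointwise). [folklore] -/
theorem obs_shift (D : DiscreteDobrushin) (x : Site 2) (i : Fin 2) :
    (shift T w d hd).obs D x i = T.obs D (x + w) i := by
  unfold shift
  rw [RealForm.obs_mk, LocalParafermionicTemplate.obs_eq]
  refine integral_congr_ae (Eventually.of_forall fun ω => ?_)
  dsimp only
  refine Finset.sum_congr rfl fun k _ => ?_
  rw [shift_pattern_eq hd, map_add_map_add]

/-- A deep point of the translate is a deep point of `T` at the translated site. [folklore] -/
theorem isDeep_add_of_isDeep_shift {D : DiscreteDobrushin} {x : Site 2} {i : Fin 2}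
    (h : (shift T w d hd).IsDeep D x i) : T.IsDeep D (x + w) i := by
  intro e he
  have h' := h (Sym2.map (· + w) e) (edist_map_add_le_of_le (hd i) he)
  rwa [map_add_map_add] at h'

/-- **Translation preserves exact discrete holomorphicity in a domain**: the Cauchy–Riemann
relation of the translate at a deep stencil based at `x` is the relation of `T` at the stencil
based at `x + w`, which is deep for `T`. [folklore] -/
theorem isExactCRIn_shift {D : DiscreteDobrushin} (h : T.IsExactCRIn D) :
    (shift T w d hd).IsExactCRIn D := by
  constructor
  · intro x h0 h1 h2 h3
    have k := h.1 (x + w) (isDeep_add_of_isDeep_shift h0) (isDeep_add_of_isDeep_shift h1)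
      (by simpa only [sub_add_eq_add_sub] using isDeep_add_of_isDeep_shift h2)
      (by simpa only [sub_add_eq_add_sub] using isDeep_add_of_isDeep_shift h3)
    simp only [obs_shift, sub_add_eq_add_sub]
    exact k
  · intro f h0 h1 h2 h3
    have k := h.2 (f + w) (isDeep_add_of_isDeep_shift h0)
      (by simpa only [add_right_comm] using isDeep_add_of_isDeep_shift h1)
      (isDeep_add_of_isDeep_shift h2)
      (by simpa only [add_right_comm] using isDeep_add_of_isDeep_shift h3)
    simp only [obs_shift, add_right_comm _ _ w]
    exact k

/-- **Translation preserves exact discrete holomorphicity** (all admissible domains). [folklore] -/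
theorem isExactCR_shift (h : T.IsExactCR) : (shift T w d hd).IsExactCR :=
  fun D hD hA => isExactCRIn_shift (h D hD hA)

/-! ### Range padding and forward differences -/

/-- The zero translation moves no base vertex. [folklore] -/
theorem edist_baseVertex_map_add_zero_le (d : ℕ) (i : Fin 2) :
    medialGraph.edist s((0 : Site 2), Pi.single i 1)
      (Sym2.map (· + (0 : Site 2)) s((0 : Site 2), Pi.single i 1)) ≤ (d : ℕ∞) := by
  rw [map_add_zero, SimpleGraph.edist_self]
  exact bot_le

/-- **Range padding**: the same template declared with range `T.r + d` (local weights restricted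
to the original window). [folklore] -/
def pad (T : LocalParafermionicTemplate) (d : ℕ) : LocalParafermionicTemplate :=
  shift T 0 d (edist_baseVertex_map_add_zero_le d)

/-- The range of a padded template. [folklore] -/
theorem pad_r (T : LocalParafermionicTemplate) (d : ℕ) : (pad T d).r = T.r + d := rfl

/-- Padding does not change the observable. [folklore] -/
theorem obs_pad (T : LocalParafermionicTemplate) (d : ℕ) (D : DiscreteDobrushin) (x : Site 2)
    (i : Fin 2) : (pad T d).obs D x i = T.obs D x i := by
  rw [pad, obs_shift, add_zero]

/-- Padding preserves exact discrete holomorphicity in a domain. [folklore] -/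
theorem isExactCRIn_pad {T : LocalParafermionicTemplate} (d : ℕ) {D : DiscreteDobrushin}
    (h : T.IsExactCRIn D) : (pad T d).IsExactCRIn D :=
  isExactCRIn_shift h

/-- The unit translate `T(· + e_j)` (range `T.r + 2`). [folklore] -/
def unitShift (T : LocalParafermionicTemplate) (j : Fin 2) : LocalParafermionicTemplate :=
  shift T (Pi.single j 1) 2 fun i => edist_baseVertex_map_add_single_le i j

/-- The observable of the unit translate. [folklore] -/
theorem obs_unitShift (T : LocalParafermionicTemplate) (j : Fin 2) (D : DiscreteDobrushin)
    (x : Site 2) (i : Fin 2) : (unitShift T j).obs D x i = T.obs D (x + Pi.single j 1) i :=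
  obs_shift D x i

/-- The two summands of a forward difference have the same range `T.r + 2`. [folklore] -/
theorem fdiff_range_eq (T : LocalParafermionicTemplate) (j : Fin 2) :
    (smul (-1) (pad T 2)).r = (unitShift T j).r := rfl

/-- **The forward difference** `∂_j T = T(· + e_j) − T` of a template in the coordinate direction
`j`, a template of range `T.r + 2`. [folklore] -/
def fdiff (T : LocalParafermionicTemplate) (j : Fin 2) : LocalParafermionicTemplate :=
  append (unitShift T j) (smul (-1) (pad T 2)) (fdiff_range_eq T j)

/-- The range of a forward difference is `T.r + 2`. [folklore] -/
theorem fdiff_r (T : LocalParafermionicTemplate) (j : Fin 2) : (fdiff T j).r = T.r + 2 := rfl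

/-- **The observable of the forward difference is the forward difference of the observable** (in
an admissible domain, where the template integrands are integrable). [folklore] -/
theorem obs_fdiff (T : LocalParafermionicTemplate) (j : Fin 2) {D : DiscreteDobrushin}
    (hD : D.IsZdAdmissible) (x : Site 2) (i : Fin 2) :
    (fdiff T j).obs D x i = T.obs D (x + Pi.single j 1) i - T.obs D x i := by
  rw [fdiff, obs_append _ _ (fdiff_range_eq T j) hD, obs_smul, obs_unitShift, obs_pad]
  ring

/-- **Forward differences preserve exact discrete holomorphicity in an admissible domain.**
[folklore] -/
theorem isExactCRIn_fdiff {T : LocalParafermionicTemplate} (j : Fin 2) {D : DiscreteDobrushin}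
    (hD : D.IsZdAdmissible) (h : T.IsExactCRIn D) : (fdiff T j).IsExactCRIn D :=
  isExactCRIn_append (fdiff_range_eq T j) hD (isExactCRIn_shift h)
    (isExactCRIn_smul (-1) (isExactCRIn_pad 2 h))

/-- **Forward differences preserve exact discrete holomorphicity**: the exactly-CR class of
route `CardyDualCurrent` is stable under `T ↦ T(· + e_j) − T` (range `r ↦ r + 2`). [folklore] -/
theorem isExactCR_fdiff {T : LocalParafermionicTemplate} (j : Fin 2) (h : T.IsExactCR) :
    (fdiff T j).IsExactCR :=
  fun D hD hA => isExactCRIn_fdiff j hD (h D hD hA)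

/-! ### Headline statements in the tree's vocabulary (registered sub-goals of the crux) -/

/-- **Unit translates of exactly-CR templates are exactly-CR templates** (of range `r + 2`, with
the translated observable in every discrete domain): closed form of `isExactCR_shift` /
`obs_unitShift`, registered sub-goal `exists_isExactCR_unitShift` of crux
stmt-CriticalPhenomena-11394. [folklore] -/
theorem exists_isExactCR_unitShift : ∀ (T : Literature.Probability.LatticeModels.LocalParafermionicTemplate) (j : Fin 2), T.IsExactCR → ∃ T' : Literature.Probability.LatticeModels.LocalParafermionicTemplate, T'.r = T.r + 2 ∧ T'.IsExactCR ∧ ∀ (D : Literature.Probability.LatticeModels.DiscreteDobrushin) (x : Literature.Probability.LatticeModels.Site 2) (i : Fin 2), T'.obs D x i = T.obs D (x + Pi.single j 1) i :=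
  fun T j h => ⟨unitShift T j, rfl, isExactCR_shift h, obs_unitShift T j⟩

/-- **Forward differences of exactly-CR templates are exactly-CR templates** (of range `r + 2`,
with observable `G(x + e_j) − G(x)` in every admissible domain): closed form of `isExactCR_fdiff` /
`obs_fdiff`, registered sub-goal `exists_isExactCR_fdiff` of crux stmt-CriticalPhenomena-11394.
So the exactly-CR class of `DualCurrentTemplateR` contains, with any member, all its lattice
derivatives — it fixes no scaling dimension. [folklore] -/
theorem exists_isExactCR_fdiff : ∀ (T : Literature.Probability.LatticeModels.LocalParafermionicTemplate) (j : Fin 2), T.IsExactCR → ∃ T' : Literature.Probability.LatticeModels.LocalParafermionicTemplate, T'.r = T.r + 2 ∧ T'.IsExactCR ∧ ∀ (D : Literature.Probability.LatticeModels.DiscreteDobrushin), D.IsZdAdmissible → ∀ (x : Literature.Probability.LatticeModels.Site 2) (i : Fin 2), T'.obs D x i = T.obs D (x + Pi.single j 1) i - T.obs D x i :=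
  fun T j h => ⟨fdiff T j, rfl, isExactCR_fdiff j h, fun _ hD x i => obs_fdiff T j hD x i⟩

end Shift

end Summit.CriticalPhenomena.CardyFormulaZ2.Cruxes.CanonicalLimitFromExactCR.Birth

end
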